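import Summits.QuantumFields.QCD.Theorems.HeatSlicedQuarksRobustYangMillsHandoverTransferFormsEmbed
import Mathlib.MeasureTheory.Function.L2Space

/-!
# The `L²` embedding of the form core: existence, norm, kernel and linearity
(crux `HeatSlicedQuarks.RobustYangMillsHandover`, item stmt-QuantumFields-8892, line `pin-the-infimum`;
registered wave-2 sub-goal `embed_package` of the lead skeleton, `--supports stmt-QuantumFields-8892`)

The lead realises Smit's transfer matrix of lattice QCD `T̂ = T̂_F^{1/2} T̂_U T̂_F^{1/2}` (Smit (6.87)) on the
Hilbert space `H = L²(ν)`, `ν = sliceHaar S ⊗ count` on `SU(3)^{Edge 3 S} × J` with `J ≃ Finset ι` a finite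
measurable enumeration of the occupation basis of the slice quark Fock space.  Continuous Fock-vector-valued wave
functions `Ψ : SU(3)^{Edge 3 S} → (Finset ι → ℂ)` are embedded as `fΨ(U, j) = (R(U) Ψ(U))_{e⁻¹ j}`, where `R(U)`
is a continuous Hermitian square root of the fermionic transfer operator, `R(U)² = T̂_F(U) = fermionSliceOp U mq`
(a hypothesis).

This file is the bookkeeping package of that embedding:

* existence: for continuous `Ψ` the function `(U, j) ↦ (R(U)Ψ(U))_{e⁻¹ j}` is continuous in `U` for each `j`,
  hence measurable on the product with the countable factor `J` and bounded on the compact configuration space,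
  so it is in `L²` of the finite measure `ν` (`MemLp.of_bound`), and its class `fΨ` agrees with it `ν`-a.e.;
* norm and kernel: `‖fΨ‖² = Re 𝔫(Ψ, Ψ)` and `fΨ = 0 ↔ 𝔫(Ψ, Ψ) = 0`, from the landed identity
  `⟪fΦ, fΨ⟫ = 𝔫(Φ, Ψ)` (`inner_embed_eq_fermionWeightForm`) at `Φ = Ψ`;
* additivity and homogeneity of `Ψ ↦ fΨ` almost everywhere (`R(U)` is linear; `Lp.coeFn_add`, `Lp.coeFn_smul`).

References: J. Smit, *Introduction to Quantum Fields on a Lattice* (2023), §6.5 (6.87) [Smit2023].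
Pure theorem file (no definitions).
-/

noncomputable section

open MeasureTheory Matrix Literature.MathematicalPhysics.QuantumFieldTheory
  Literature.MathematicalPhysics.QuantumLattice
open scoped InnerProductSpace ComplexConjugate

namespace Summit.QuantumFields.QCD.Cruxes.RobustYangMillsHandover.PinTheInfimum

open Summit.QuantumFields.QCD.Cruxes.StableActionBridge.Sketch (isProbabilityMeasure_sliceHaar)
open TransferFormsEmbed (exists_bound_of_continuous₁ inner_embed_eq_fermionWeightForm)

namespace EmbedPackage

variable {Nf S : ℕ} [NeZero S]

/-- The embedded wave `(U, j) ↦ (R(U)Ψ(U))_{e⁻¹ j}` of a continuous `Ψ` (with `R` continuous) is in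
`L²(sliceHaar ⊗ count)`: it is measurable (continuous sections, countable second factor) and bounded on the compact
configuration space, and the measure is finite. [folklore] -/
theorem memLp_embed (J : Type) [Fintype J] [MeasurableSpace J] [MeasurableSingletonClass J]
    (e : Finset (SliceFermiIdx Nf S) ≃ J)
    {R : GaugeConfig 3 S (specialUnitaryGroup (Fin 3) ℂ) →
      Matrix (Finset (SliceFermiIdx Nf S)) (Finset (SliceFermiIdx Nf S)) ℂ}
    (hR : Continuous R) {Ψ : SliceWave Nf S} (hΨ : Continuous Ψ) :
    MemLp (fun p : GaugeConfig 3 S (specialUnitaryGroup (Fin 3) ℂ) × J => (R p.1 *ᵥ Ψ p.1) (e.symm p.2)) 2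
      ((sliceHaar S).prod (Measure.count : Measure J)) := by
  haveI := isProbabilityMeasure_sliceHaar S
  have hb : Continuous fun U => R U *ᵥ Ψ U := hR.matrix_mulVec hΨ
  obtain ⟨C, hC⟩ := exists_bound_of_continuous₁ hb
  exact MemLp.of_bound
    (measurable_from_prod_countable_left
      fun j => ((continuous_apply (e.symm j)).comp hb).measurable).aestronglyMeasurable C
    (Filter.Eventually.of_forall fun p => hC p.1 (e.symm p.2))

/-- Existence of the embedded `L²` class `fΨ` of a continuous wave `Ψ`, agreeing a.e. with
`(U, j) ↦ (R(U)Ψ(U))_{e⁻¹ j}`. [folklore] -/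
theorem exists_embed (J : Type) [Fintype J] [MeasurableSpace J] [MeasurableSingletonClass J]
    (e : Finset (SliceFermiIdx Nf S) ≃ J)
    {R : GaugeConfig 3 S (specialUnitaryGroup (Fin 3) ℂ) →
      Matrix (Finset (SliceFermiIdx Nf S)) (Finset (SliceFermiIdx Nf S)) ℂ}
    (hR : Continuous R) {Ψ : SliceWave Nf S} (hΨ : Continuous Ψ) :
    ∃ f : Lp ℂ 2 ((sliceHaar S).prod (Measure.count : Measure J)),
      (f : GaugeConfig 3 S (specialUnitaryGroup (Fin 3) ℂ) × J → ℂ)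
        =ᵐ[(sliceHaar S).prod (Measure.count : Measure J)] fun p => (R p.1 *ᵥ Ψ p.1) (e.symm p.2) :=
  ⟨(memLp_embed J e hR hΨ).toLp _, MemLp.coeFn_toLp _⟩

/-- Norm and kernel of the embedding: `‖fΨ‖² = Re 𝔫(Ψ, Ψ)` and `fΨ = 0 ↔ 𝔫(Ψ, Ψ) = 0`, from
`⟪fΨ, fΨ⟫ = 𝔫(Ψ, Ψ)`. [cite: Smit2023, §6.5 (6.87)] -/
theorem norm_sq_embed_and_eq_zero_iff (mq : Fin Nf → ℝ)
    (J : Type) [Fintype J] [MeasurableSpace J] [MeasurableSingletonClass J]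
    (e : Finset (SliceFermiIdx Nf S) ≃ J)
    {R : GaugeConfig 3 S (specialUnitaryGroup (Fin 3) ℂ) →
      Matrix (Finset (SliceFermiIdx Nf S)) (Finset (SliceFermiIdx Nf S)) ℂ}
    (hR : Continuous R) (hRh : ∀ U, (R U)ᴴ = R U) (hRsq : ∀ U, R U * R U = fermionSliceOp U mq)
    {Ψ : SliceWave Nf S} (hΨ : Continuous Ψ) (f : Lp ℂ 2 ((sliceHaar S).prod (Measure.count : Measure J)))
    (hf : (f : GaugeConfig 3 S (specialUnitaryGroup (Fin 3) ℂ) × J → ℂ)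
      =ᵐ[(sliceHaar S).prod (Measure.count : Measure J)] fun p => (R p.1 *ᵥ Ψ p.1) (e.symm p.2)) :
    ‖f‖ ^ 2 = (fermionWeightForm mq Ψ Ψ).re ∧ (f = 0 ↔ fermionWeightForm mq Ψ Ψ = 0) := by
  have h := inner_embed_eq_fermionWeightForm Nf S mq J e _ hR hRh hRsq Ψ Ψ hΨ hΨ f f hf hf
  refine ⟨?_, ?_⟩
  · rw [← h, ← inner_self_eq_norm_sq (𝕜 := ℂ) f, RCLike.re_to_complex]
  · rw [← h]
    exact inner_self_eq_zero.symm

/-- Additivity of the embedding almost everywhere: `f_Φ + f_Ψ = f_{Φ + Ψ}` (`R(U)` is linear). [folklore] -/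
theorem embed_add (J : Type) [MeasurableSpace J] (e : Finset (SliceFermiIdx Nf S) ≃ J)
    (R : GaugeConfig 3 S (specialUnitaryGroup (Fin 3) ℂ) →
      Matrix (Finset (SliceFermiIdx Nf S)) (Finset (SliceFermiIdx Nf S)) ℂ)
    (Φ Ψ : SliceWave Nf S) (f g : Lp ℂ 2 ((sliceHaar S).prod (Measure.count : Measure J)))
    (hf : (f : GaugeConfig 3 S (specialUnitaryGroup (Fin 3) ℂ) × J → ℂ)
      =ᵐ[(sliceHaar S).prod (Measure.count : Measure J)] fun p => (R p.1 *ᵥ Φ p.1) (e.symm p.2))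
    (hg : (g : GaugeConfig 3 S (specialUnitaryGroup (Fin 3) ℂ) × J → ℂ)
      =ᵐ[(sliceHaar S).prod (Measure.count : Measure J)] fun p => (R p.1 *ᵥ Ψ p.1) (e.symm p.2)) :
    ((f + g : Lp ℂ 2 ((sliceHaar S).prod (Measure.count : Measure J))) :
        GaugeConfig 3 S (specialUnitaryGroup (Fin 3) ℂ) × J → ℂ)
      =ᵐ[(sliceHaar S).prod (Measure.count : Measure J)] fun p => (R p.1 *ᵥ (Φ + Ψ) p.1) (e.symm p.2) := by
  filter_upwards [Lp.coeFn_add f g, hf, hg] with p h1 h2 h3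
  rw [h1, Pi.add_apply, h2, h3, Pi.add_apply, Matrix.mulVec_add, Pi.add_apply]

/-- Homogeneity of the embedding almost everywhere: `c • f_Ψ = f_{c • Ψ}` (`R(U)` is linear). [folklore] -/
theorem embed_smul (J : Type) [MeasurableSpace J] (e : Finset (SliceFermiIdx Nf S) ≃ J)
    (R : GaugeConfig 3 S (specialUnitaryGroup (Fin 3) ℂ) →
      Matrix (Finset (SliceFermiIdx Nf S)) (Finset (SliceFermiIdx Nf S)) ℂ)
    (c : ℂ) (Ψ : SliceWave Nf S) (f : Lp ℂ 2 ((sliceHaar S).prod (Measure.count : Measure J)))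
    (hf : (f : GaugeConfig 3 S (specialUnitaryGroup (Fin 3) ℂ) × J → ℂ)
      =ᵐ[(sliceHaar S).prod (Measure.count : Measure J)] fun p => (R p.1 *ᵥ Ψ p.1) (e.symm p.2)) :
    ((c • f : Lp ℂ 2 ((sliceHaar S).prod (Measure.count : Measure J))) :
        GaugeConfig 3 S (specialUnitaryGroup (Fin 3) ℂ) × J → ℂ)
      =ᵐ[(sliceHaar S).prod (Measure.count : Measure J)] fun p => (R p.1 *ᵥ (c • Ψ) p.1) (e.symm p.2) := by
  filter_upwards [Lp.coeFn_smul c f, hf] with p h1 h2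
  rw [h1, Pi.smul_apply, h2, Pi.smul_apply, Matrix.mulVec_smul, Pi.smul_apply]

end EmbedPackage

open EmbedPackage

/-- **The embedding package** (registered wave-2 sub-goal `embed_package` of line `pin-the-infimum`): for a
continuous Hermitian `R` with `R(U)² = T̂_F(U)` and the embedding `Ψ ↦ fΨ`, `fΨ(U, j) = (R(U)Ψ(U))_{e⁻¹ j}`, of
wave functions into `L²(sliceHaar ⊗ count)`: (1) every continuous `Ψ` has an embedded class `fΨ`;
(2) `‖fΨ‖² = Re 𝔫(Ψ, Ψ)` and `fΨ = 0 ↔ 𝔫(Ψ, Ψ) = 0`; (3) `f_Φ + f_Ψ = f_{Φ+Ψ}` and (4) `c • f_Ψ = f_{c • Ψ}`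
almost everywhere. [cite: Smit2023, §6.5 (6.87)] -/
theorem embed_package : ∀ (Nf S : ℕ) [NeZero S] (mq : Fin Nf → ℝ) (J : Type) [Fintype J] [MeasurableSpace J] [MeasurableSingletonClass J] (e : Finset (SliceFermiIdx Nf S) ≃ J) (R : GaugeConfig 3 S (Matrix.specialUnitaryGroup (Fin 3) ℂ) → Matrix (Finset (SliceFermiIdx Nf S)) (Finset (SliceFermiIdx Nf S)) ℂ), Continuous R → (∀ U, (R U)ᴴ = R U) → (∀ U, R U * R U = fermionSliceOp U mq) → (∀ Ψ : SliceWave Nf S, Continuous Ψ → ∃ f : Lp ℂ 2 ((sliceHaar S).prod (Measure.count : Measure J)), (f : GaugeConfig 3 S (Matrix.specialUnitaryGroup (Fin 3) ℂ) × J → ℂ) =ᵐ[(sliceHaar S).prod (Measure.count : Measure J)] fun p => (R p.1 *ᵥ Ψ p.1) (e.symm p.2)) ∧ (∀ Ψ : SliceWave Nf S, Continuous Ψ → ∀ f : Lp ℂ 2 ((sliceHaar S).prod (Measure.count : Measure J)), ((f : GaugeConfig 3 S (Matrix.specialUnitaryGroup (Fin 3) ℂ) × J → ℂ) =ᵐ[(sliceHaar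 S).prod (Measure.count : Measure J)] fun p => (R p.1 *ᵥ Ψ p.1) (e.symm p.2)) → ‖f‖ ^ 2 = (fermionWeightForm mq Ψ Ψ).re ∧ (f = 0 ↔ fermionWeightForm mq Ψ Ψ = 0)) ∧ (∀ (Φ Ψ : SliceWave Nf S) (f g : Lp ℂ 2 ((sliceHaar S).prod (Measure.count : Measure J))), ((f : GaugeConfig 3 S (Matrix.specialUnitaryGroup (Fin 3) ℂ) × J → ℂ) =ᵐ[(sliceHaar S).prod (Measure.count : Measure J)] fun p => (R p.1 *ᵥ Φ p.1) (e.symm p.2)) → ((g : GaugeConfig 3 S (Matrix.specialUnitaryGroup (Fin 3) ℂ) × J → ℂ) =ᵐ[(sliceHaar S).prod (Measure.count : Measure J)] fun p => (R p.1 *ᵥ Ψ p.1) (e.symm p.2)) → ((f + g : Lp ℂ 2 ((sliceHaar S).prod (Measure.count : Measure J))) : GaugeConfig 3 S (Matrix.specialUnitaryGroup (Fin 3) ℂ) × J → ℂ) =ᵐ[(sliceHaar S).prod (Measure.count : Measure J)] fun p => (R p.1 *ᵥ (Φ + Ψ) p.1) (e.symm p.2)) ∧ ∀ (c : ℂ)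 (Ψ : SliceWave Nf S) (f : Lp ℂ 2 ((sliceHaar S).prod (Measure.count : Measure J))), ((f : GaugeConfig 3 S (Matrix.specialUnitaryGroup (Fin 3) ℂ) × J → ℂ) =ᵐ[(sliceHaar S).prod (Measure.count : Measure J)] fun p => (R p.1 *ᵥ Ψ p.1) (e.symm p.2)) → ((c • f : Lp ℂ 2 ((sliceHaar S).prod (Measure.count : Measure J))) : GaugeConfig 3 S (Matrix.specialUnitaryGroup (Fin 3) ℂ) × J → ℂ) =ᵐ[(sliceHaar S).prod (Measure.count : Measure J)] fun p => (R p.1 *ᵥ (c • Ψ) p.1) (e.symm p.2) := by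
  intro Nf S _ mq J _ _ _ e R hR hRh hRsq
  exact ⟨fun Ψ hΨ => exists_embed J e hR hΨ,
    fun Ψ hΨ f hf => norm_sq_embed_and_eq_zero_iff mq J e hR hRh hRsq hΨ f hf,
    fun Φ Ψ f g hf hg => embed_add J e R Φ Ψ f g hf hg,
    fun c Ψ f hf => embed_smul J e R c Ψ f hf⟩

end Summit.QuantumFields.QCD.Cruxes.RobustYangMillsHandover.PinTheInfimum

end
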